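import Summits.BirchSwinnertonDyer.BirchSwinnertonDyer.Theses.UniversalToricDescent
import Summits.BirchSwinnertonDyer.BirchSwinnertonDyer.Theorems.UniversalToricDescentToricTransportModThreeTwinMuZero
import Literature.NumberTheory.EllipticCurves.Hsieh2014.AnticyclotomicMuInvariantAnyLevel

/-! # pen bsd-wall-pss3x g9 — RK-7 **v3-pen** (renderable form of vet-utdR3 g1's CV3 `closes_v3`).
The route file's `closes` cannot cite a BY-NAME Theorems decl (those modules import the route file), so CV3's
`have hTμ := twinMuZeroAtThree_of_item27933 hThmB` becomes ONE glue support item `TwinMuZeroAtThreeOfThmB`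
(closed at once by the 3-line by-name closer `twinMuZeroAtThreeOfThmB_closer` below, filed by LEAD as a Theorems file).
NEW ITEMS: `ToricDefectEitherRoadAlgMuAtThree` (package P‴ = 24255 minus its `TwinMuZeroAtThree` conjuncts; WEAKER),
`TwinMuZeroAtThreeOfThmB` (glue). NEW DISPLAYED PRINT BINDER `hThmB : TwinHsiehThmBInput` (existing item). Kernels hK (22543) / hKr (24256) UNCHANGED.
No B, no T, no h422. 14 binders. -/

namespace Summit.BirchSwinnertonDyer.BirchSwinnertonDyer.Theses.UniversalToricDescent.RK7v3

/-- package P‴ (support r9): live 24255 `ToricDefectEitherRoadMuAtThree` with the conjunct `TwinMuZeroAtThree` removed on both roads. -/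
def ToricDefectEitherRoadAlgMuAtThree : Prop :=
  (DefectTransportModThreePT ∧ AdditiveSplitIMCInclusionAtThree) ∨
    (SigmaCongruenceAtThree ∧ RationalSplitIMCInclusionAtThree ∧ TwinAlgMuZeroAtThree)

/-- glue (support r9): the twin's analytic μ = 0 at 3 (live 20400, by name) from the print input Hsieh Thm B (item `TwinHsiehThmBInput`, by name). -/
def TwinMuZeroAtThreeOfThmB : Prop :=
  TwinHsiehThmBInput → TwinMuZeroAtThree

theorem pkgAlgMu_of_pkg (h : ToricDefectEitherRoadMuAtThree) : ToricDefectEitherRoadAlgMuAtThree :=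
  h.elim (fun h ↦ Or.inl ⟨h.1, h.2.1⟩) (fun h ↦ Or.inr ⟨h.1, h.2.1, h.2.2.2⟩)

/-- the glue item's closer (what LEAD files as a 3-line Theorems file `--workitem <G id>`): p540587 ∘ Literature bookkeeping. -/
theorem twinMuZeroAtThreeOfThmB_closer : TwinMuZeroAtThreeOfThmB := fun hThmB ↦
  Summit.BirchSwinnertonDyer.BirchSwinnertonDyer.Theorems.UniversalToricDescentTwinMuZero.twinMuZeroAtThree_of_thmB
    (Literature.NumberTheory.EllipticCurves.Hsieh2014.thmB_exists_isHsiehLFunction_coeff_norm_eq_one_of_anyLevel hThmB)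

/-- v3-pen `closes` (= rk7v3/glue_v6.lean verbatim up to the namespace): 14 binders, kernels unchanged, `TwinMuZeroAtThree` derived as `hG hThmB`. -/
theorem closes_v6 (hF : ToricPublishedInputs) (hThmB : TwinHsiehThmBInput) (hG : TwinMuZeroAtThreeOfThmB) (hP : ToricDefectEitherRoadAlgMuAtThree) (hB : TwinDegreeFrameAtThreeMultTresT) (hC : TwinDegreeFrameAtThreeGoodSSApZeroT) (hsupply : GoodSSApZeroTwinSupplyAtThree) (hR : PeuRamifieMultTwinResupplyAtThree) (hW : WildSplitPrintedInputsAtThree) (hS : WildSplitFrameAtThreeOddOfPrint) (hL : ToricPrintedLeavesAtThree) (hZ : WildRankZeroTwistAtThree) (hK : ToricKernelAtThreeApZeroOddDegreeOfPrint) (hKr : ToricKernelAtThreeApZeroOddRationalTwinMuOfPrint) : Summit.BirchSwinnertonDyer.WAllExclAddWildRankOneSurjTwin := hP.elim (fun h ↦ Summit.BirchSwinnertonDyer.wAllExclAddWildRankOneSurjTwin_of_forall (hK hF h.1 h.2 (hG hThmB) ⟨hB, hC⟩ hsupply hR hW hS hL hZ)) (fun h ↦ Summit.BirchSwinnertonDyer.wAllExclAddWildRankOneSurjTwin_of_forall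 (hKr hF h.1 h.2.1 (hG hThmB) h.2.2 ⟨hB, hC⟩ hsupply hR hW hS hL hZ))

/-- sanity: the live rev-88 `closes` follows from v6 (v3-pen is a conservative re-keying). -/
theorem closes_live_of_v6 (hF : ToricPublishedInputs) (hThmB : TwinHsiehThmBInput) (hP : ToricDefectEitherRoadMuAtThree) (hB : TwinDegreeFrameAtThreeMultTresT) (hC : TwinDegreeFrameAtThreeGoodSSApZeroT) (hsupply : GoodSSApZeroTwinSupplyAtThree) (hR : PeuRamifieMultTwinResupplyAtThree) (hW : WildSplitPrintedInputsAtThree) (hS : WildSplitFrameAtThreeOddOfPrint) (hL : ToricPrintedLeavesAtThree) (hZ : WildRankZeroTwistAtThree) (hK : ToricKernelAtThreeApZeroOddDegreeOfPrint) (hKr : ToricKernelAtThreeApZeroOddRationalTwinMuOfPrint) : Summit.BirchSwinnertonDyer.WAllExclAddWildRankOneSurjTwin :=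
  closes_v6 hF hThmB twinMuZeroAtThreeOfThmB_closer (pkgAlgMu_of_pkg hP) hB hC hsupply hR hW hS hL hZ hK hKr

end Summit.BirchSwinnertonDyer.BirchSwinnertonDyer.Theses.UniversalToricDescent.RK7v3
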